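import Summits.ValiantsHypothesis.ValiantsHypothesis.Theorems.BarrierLeverSuccinctHittingSetsForVPLevelOne
import Summits.ValiantsHypothesis.ValiantsHypothesis.Theorems.BarrierLeverSuccinctHittingSetsForVPGeneratorEquivalence
import Summits.ValiantsHypothesis.ValiantsHypothesis.Theorems.BarrierLeverSuccinctHittingSetsForVPUniversalJoint
import Literature.Barriers.ValiantsHypothesis.AlgebraicNaturalProofsKRSTVNP
import Literature.Computability.AlgebraicComplexity.ValiantClassesProofs

/-!
# Crux `BarrierLever.SuccinctHittingSetsForVP` (stmt-ValiantsHypothesis-14610) — the WIN–WIN under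
# hardness of the permanent, and the jointly-succinct-generator door is exactly the crux

Lean text after the cell planner seat `valiant-natproofs-p1` (gen 3, HOME/p1/Chain3.lean §0/§3/§5),
landed by the prover seat against the TREE's unconditional KRST theorem
(`Literature.Barriers.ValiantsHypothesis.succinctHittingSetsFromVNP_of_permanentExpHard`,
`AlgebraicNaturalProofsKRSTVNP.lean`: no named-fact hypothesis) and the tree's universal jointness
(`…UniversalJoint.universalJointness`). The open hypotheses of p1's `Chain3.lean` §0
(`PerExpHard`, `KRSTForVP`, `VPGeneratorFromHardPermanent`, `UniversalJointness`, `KRST2022`) are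
parameterless Props; per D-0059 they live on the ledger as STATEMENT ITEMS, so here every one of
them is SPELLED OUT as a hypothesis (no `def … : Prop` — the gate would relocate it). Does NOT close
the item.

* `NaturalProofsSeparate b₁` — "level-one natural proofs separate `VNP_{·,b₁}` (the tree's
  `SmallDefinable ℂ · b₁`) from every `VP_{·,b}`, infinitely often".
* `not_succinctHittingSetsForVP_of_separate` (unconditional), `separate_of_not_succinctHittingSetsForVP`
  (from KRST's conclusion), `not_succinctHittingSetsForVP_iff_separate`.
* **`win_win`** — `PermanentExpHardWith ℂ c m₀ → SuccinctHittingSetsForVP ℂ ∨ ∃ b₁, NaturalProofsSeparate b₁`: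
  under exponential hardness of the permanent EITHER the full algebraic natural-proofs barrier for
  `VP` holds OR level-one natural proofs separate `VNP_{·,b₁}` from every `VP_{·,b}` infinitely
  often — never both. KRST's "evidence for both sides" as ONE kernel theorem with NO named-fact
  hypothesis (the `VNP` half is the tree's unconditional KRST theorem).
* **`generator_iff_krstForVP`** — ★★ ↔ ★ unconditionally: "per-hardness ⇒ a jointly `VP`-succinct
  generator fooling level one" ↔ "per-hardness ⇒ Question 6" (p1's `generator_iff_krstForVP'`; the
  backward direction is universal jointness).

WHAT THIS IS NOT: not a lower bound; no claim about which disjunct holds; the hardness of the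
permanent stays a hypothesis.

References: [KumarRamyaSaptharishiTengse2022] §1.2, Thm. MainThm; [ForbesShpilkaVolk2018] Question 6,
Lemma 13.
-/

-- layout Summits/ValiantsHypothesis/ValiantsHypothesis forces the duplicated namespace component
set_option linter.dupNamespace false

noncomputable section

namespace Summit.ValiantsHypothesis.ValiantsHypothesis.Theorems.BarrierLever.SuccinctHittingSetsForVP

namespace WinWin

open Literature.Barriers.ValiantsHypothesis Literature.Computability.AlgebraicComplexity MvPolynomial
open Summit.ValiantsHypothesis.ValiantsHypothesis.Theorems.BarrierLever.SuccinctHittingSetsForVP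

/-! ### §5 of Chain3: the win–win -/

/-- **Natural proofs separate `VNP_{·,b₁}` from every `VP_{·,b}`, infinitely often**: for every `b`
and `n₀` there are `n ≥ n₀`, a level-one natural proof `D` against `SmallCircuits ℂ n b` and a
member `g` of the `VNP`-succinct class `SmallDefinable ℂ n b₁` with `D(coeff g) ≠ 0`.
[cite: KumarRamyaSaptharishiTengse2022, §1.2] -/
def NaturalProofsSeparate (b₁ : ℕ) : Prop :=
  ∀ b n₀ : ℕ, ∃ n : ℕ, n₀ ≤ n ∧
    ∃ D, IsNaturalProof (degLEMonomials n) (SmallCircuits ℂ n b) (Distinguishers ℂ n 1) D ∧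
      ∃ g ∈ SmallDefinable ℂ n b₁, eval (coeffVector (degLEMonomials n) g) D ≠ 0

/-- One half, unconditionally: if natural proofs separate, Question 6 fails.
[cite: ForbesShpilkaVolk2018, Question 6] -/
theorem not_succinctHittingSetsForVP_of_separate {b₁ : ℕ} (h : NaturalProofsSeparate b₁) :
    ¬ SuccinctHittingSetsForVP ℂ := by
  intro hQ
  have hQ' : Summit.ValiantsHypothesis.ValiantsHypothesis.Theses.BarrierLever.SuccinctHittingSetsForVP := hQ
  obtain ⟨b, n₀, hlevel⟩ := levelOne_of_succinctHittingSetsForVP hQ'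
  obtain ⟨n, hn, D, ⟨hD, hD0, hvan⟩, _⟩ := h b n₀
  obtain ⟨f, hf, hne⟩ := hlevel n hn D hD hD0
  exact hne (hvan f hf)

/-- The other half, from KRST's conclusion (ONE `b₁` for every level suffices at level one): if
Question 6 fails, the equations it provides are nonzero on some `VNP_{n,b₁}`-polynomial.
[cite: KumarRamyaSaptharishiTengse2022, Thm. MainThm] -/
theorem separate_of_not_succinctHittingSetsForVP {b₁ : ℕ}
    (hK : ∀ a : ℕ, ∃ n₀ : ℕ, ∀ n : ℕ, n₀ ≤ n →
      IsSuccinctHittingSet (degLEMonomials n) (SmallDefinable ℂ n b₁) (Distinguishers ℂ n a))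
    (hQ : ¬ SuccinctHittingSetsForVP ℂ) : NaturalProofsSeparate b₁ := by
  obtain ⟨n₁, hn₁⟩ := hK 1
  intro b n₀
  by_contra hcon
  push Not at hcon
  apply hQ
  refine stub_levelCollapse ⟨b, max n₀ n₁, fun n hn D hD hD0 => ?_⟩
  have hn₀ : n₀ ≤ n := (le_max_left _ _).trans hn
  have hn1 : n₁ ≤ n := (le_max_right _ _).trans hn
  by_contra hnohit
  push Not at hnohit
  have hnat : IsNaturalProof (degLEMonomials n) (SmallCircuits ℂ n b) (Distinguishers ℂ n 1) D :=
    ⟨hD, hD0, hnohit⟩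
  obtain ⟨g, hg, hgne⟩ := hn₁ n hn1 D hD hD0
  exact hgne (hcon n hn₀ D hnat g hg)

/-- **The dichotomy**: given KRST's conclusion for the exponent `b₁`, Question 6 FAILS iff natural
proofs separate `VNP_{·,b₁}`. [cite: KumarRamyaSaptharishiTengse2022, §1.2] -/
theorem not_succinctHittingSetsForVP_iff_separate {b₁ : ℕ}
    (hK : ∀ a : ℕ, ∃ n₀ : ℕ, ∀ n : ℕ, n₀ ≤ n →
      IsSuccinctHittingSet (degLEMonomials n) (SmallDefinable ℂ n b₁) (Distinguishers ℂ n a)) :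
    ¬ SuccinctHittingSetsForVP ℂ ↔ NaturalProofsSeparate b₁ :=
  ⟨separate_of_not_succinctHittingSetsForVP hK, not_succinctHittingSetsForVP_of_separate⟩

/-- **WIN–WIN under exponential hardness of the permanent — no named-fact hypothesis.** If
`2^j ≤ L(per_{j^c})` for all `j ≥ m₀`, then EITHER the full algebraic natural-proofs barrier for
`VP` holds (FSV Question 6) OR, for the exponent `b₁` of the tree's KRST theorem, level-one natural
proofs separate `VNP_{·,b₁}` from every `VP_{·,b}` infinitely often; and never both
(`not_succinctHittingSetsForVP_of_separate`). [cite: KumarRamyaSaptharishiTengse2022, §1.2] -/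
theorem win_win {c m₀ : ℕ} (hper : PermanentExpHardWith ℂ c m₀) :
    SuccinctHittingSetsForVP ℂ ∨ ∃ b₁, NaturalProofsSeparate b₁ := by
  by_cases hQ : SuccinctHittingSetsForVP ℂ
  · exact Or.inl hQ
  · obtain ⟨b₁, hb₁⟩ := succinctHittingSetsFromVNP_of_permanentExpHard (F := ℂ) hper
    exact Or.inr ⟨b₁, separate_of_not_succinctHittingSetsForVP hb₁ hQ⟩

/-! ### §3 of Chain3: the jointly-succinct-generator door is exactly the crux (★★ ↔ ★) -/

/-- A jointly succinct generator maps INTO `coeff(SmallCircuits ℂ n b)` (the seed specialisation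
of the joint witness is a projection of it). [cite: ForbesShpilkaVolk2018, Lemma 13] -/
theorem into_of_jointlySuccinct {n q b : ℕ} {G : degLEMonomials n → MvPolynomial (Fin q) ℂ}
    (h : ∃ Γ : MvPolynomial (Fin n ⊕ Fin q) ℂ, complexity Γ ≤ n ^ b ∧
      ∀ a : Fin q → ℂ, (aeval (Sum.elim X fun j => C (a j)) Γ).totalDegree ≤ n ∧
        ∀ m : degLEMonomials n,
          coeff (m : Fin n →₀ ℕ) (aeval (Sum.elim X fun j => C (a j)) Γ) = eval a (G m)) :
    ∀ y : Fin q → ℂ, ∃ f ∈ SmallCircuits ℂ n b, ∀ m : degLEMonomials n,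
      coeff (m : Fin n →₀ ℕ) f = eval y (G m) := by
  obtain ⟨Γ, hΓ, hspec⟩ := h
  intro y
  obtain ⟨hdeg, hcoeff⟩ := hspec y
  refine ⟨aeval (Sum.elim X fun j => C (y j)) Γ, ⟨hdeg, ?_⟩, hcoeff⟩
  have hproj : IsProjection (aeval (Sum.elim X fun j => C (y j)) Γ) Γ := by
    refine ⟨Sum.elim X fun j => C (y j), fun i => ?_, rfl⟩
    cases i with
    | inl i => exact Or.inl ⟨i, rfl⟩
    | inr j => exact Or.inr ⟨y j, rfl⟩
  exact (complexity_le_of_isProjection hproj).trans hΓ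

/-- **★★ ↔ ★, unconditionally** (p1's `generator_iff_krstForVP'`): "hardness `H` ⇒ for all large
`n` a JOINTLY `VP`-succinct generator fools the level-one distinguishers" is EQUIVALENT to
"hardness `H` ⇒ FSV Question 6", for every hypothesis `H` (in particular permanent hardness). The
forward direction is the door (`succinctHittingSetsForVP_iff_generator`), the backward direction is
universal jointness (`UniversalJoint.universalJointness`). [cite: ForbesShpilkaVolk2018, Lemma 13] -/
theorem generator_iff_krstForVP (H : Prop) :
    (H → ∃ b n₀ : ℕ, ∀ n : ℕ, n₀ ≤ n → ∃ (q : ℕ) (G : degLEMonomials n → MvPolynomial (Fin q) ℂ),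
      (∃ Γ : MvPolynomial (Fin n ⊕ Fin q) ℂ, complexity Γ ≤ n ^ b ∧
        ∀ a : Fin q → ℂ, (aeval (Sum.elim X fun j => C (a j)) Γ).totalDegree ≤ n ∧
          ∀ m : degLEMonomials n,
            coeff (m : Fin n →₀ ℕ) (aeval (Sum.elim X fun j => C (a j)) Γ) = eval a (G m)) ∧
      ∀ D ∈ Distinguishers ℂ n 1, D ≠ 0 → bind₁ G D ≠ 0) ↔
    (H → SuccinctHittingSetsForVP ℂ) := by
  refine ⟨fun h hH => ?_, fun h hH => UniversalJoint.universalJointness (h hH)⟩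
  obtain ⟨b, n₀, hgen⟩ := h hH
  have key : Summit.ValiantsHypothesis.ValiantsHypothesis.Theses.BarrierLever.SuccinctHittingSetsForVP :=
    succinctHittingSetsForVP_iff_generator.mpr
      ⟨b, n₀, fun n hn => by
        obtain ⟨q, G, hJ, hF⟩ := hgen n hn
        exact ⟨q, G, into_of_jointlySuccinct hJ, hF⟩⟩
  exact key

end WinWin

end Summit.ValiantsHypothesis.ValiantsHypothesis.Theorems.BarrierLever.SuccinctHittingSetsForVP

end
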